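import Summits.QuantumFields.QCD.Theses.HeavyThresholdYMBridge
import Summits.QuantumFields.QCD.Theorems.NestedDissectionSeaSeaFactorisationBridgeStubTwoLoopHandOver

/-!
# `HeavyThresholdYMBridge.CouplingMatching` (stmt-QuantumFields-8797) — candidate proof

The decoupling/matching arithmetic for the tree's two-loop profile `afBeta`: for all `N_f`, `Λ > 0`, `M > 0`
there is `Λ′ > 0` (`log Λ′² = [b₀(N_f) log Λ² + (b₀(0) − b₀(N_f)) log M²]/b₀(0)`) such that
`afBeta 0 Λ′ a − [afBeta N_f Λ a + 2(b₀(0) − b₀(N_f)) log(1/(a²M²)) + 2(b₁(0)/b₀(0) − b₁(N_f)/b₀(N_f)) log log(1/(a²Λ²))] → 0`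
as `a → 0⁺`.  The body of the item is byte-identical to the landed stub 3a of the line `proper-time-quarantine` on the
sibling crux `NestedDissectionSea.SeaFactorisationBridge` (stmt-QuantumFields-13880):
`Summit.QuantumFields.QCD.Cruxes.SeaFactorisationBridge.ProperTimeQuarantine.stub_twoLoopHandOver`
(`Theorems/NestedDissectionSeaSeaFactorisationBridgeStubTwoLoopHandOver.lean`, p115758), so the item closes by `exact`.
Attached as a candidate proof by the 13880 line lead (c3); to be landed by the holder of 8797 as
`Theorems/HeavyThresholdYMBridgeCouplingMatching.lean --workitem stmt-QuantumFields-8797`.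
-/

namespace Summit.QuantumFields.QCD.Theorems

/-- **`CouplingMatching` holds** (stmt-QuantumFields-8797): the one-loop heavy-threshold logarithm plus the two-loop
`log log` swap convert `N_f`-flavour asymptotic scaling into pure-gauge asymptotic scaling at the matched `Λ′`.
Proof: the landed `stub_twoLoopHandOver` of the sibling crux's line, verbatim. -/
theorem couplingMatching_proof : Summit.QuantumFields.QCD.Theses.HeavyThresholdYMBridge.CouplingMatching :=
  Summit.QuantumFields.QCD.Cruxes.SeaFactorisationBridge.ProperTimeQuarantine.stub_twoLoopHandOver

end Summit.QuantumFields.QCD.Theorems
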